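import Summits.KontsevichZagierPeriods.KontsevichZagierPeriods.Theses.TerasomaMultiplication
import Literature.NumberTheory.Transcendental.KZLogCalculusProofs

/-!
# Disproof of `DasGapTwelve` — findings (standing adversary `cdisprove`, gen 1)

Crux (route TerasomaMultiplication, item stmt-KontsevichZagierPeriods-13215):
`[∫_(0,1) x^(-11/12) (1-x)^(-3/4)] ~ [∫_(0,1) c₀ · x^(-3/4) (1-x)^(-3/4)]`,
`c₀ = 2^(-1/4) · 3^(3/8) · √(1+√3)`, i.e. `B(1/12,1/4) = c₀ · B(1/4,1/4)` as a KZ-equivalence.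

## Verdict so far: NO KILL — it resists for a structural reason

1. The only invariant of `KZ.relations` in the tree or in print is the value
   (`KZ.Equivalent.value_eq_holds`).  The two values AGREE EXACTLY: Gauss multiplication (n = 3)
   at 1/12, Legendre duplication at 1/12 and 1/6 and Euler reflection at 5/12, 1/4, 1/3 give
   `Γ(1/12)² = 2^(-1/2)·3^(3/4)·(1+√3)·Γ(1/4)²Γ(1/3)²/π`, whence
   `B(1/12,1/4)/B(1/4,1/4) = Γ(1/12)√π/(Γ(1/3)Γ(1/4)) = c₀` (positive square root); numerically
   both sides are `15.5630449262489` (this session, double precision; earlier refuters: 55 digits).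
   So `¬ DasGapTwelve` would be a counterexample to Kontsevich–Zagier's Conjecture 1 for this
   calculus — out of reach of cheap attacks, and not expected.
2. NOT VACUOUS, and in fact ONE CONCRETE EQUIVALENCE: `dasGapTwelve_iff_instance :
   DasGapTwelve ↔ KZ.Equivalent repB_1_12_1_4 repC₀B` for the two explicit representations built
   in sections `Witness` / `Constant` (ℚ-semialgebraic graphs `{y>0, y^12 x^11 (1-x)^9 = 1}` and
   `{y>0, W>0, W²=34992}` with `W = y^8 x^6(1-x)^6 − 189`, since `c₀^8 = 189+108√3` (`c₀^4 = 9+6√3`); absolute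
   convergence from Mathlib's `Complex.betaIntegral_convergent`).  Provers may therefore work with
   these two concrete representations only.
3. What a kill would need: an additive invariant `FormalRep →+ A` vanishing on the four move sets
   and separating `repB_1_12_1_4` from `repC₀B` — none is known (cf. route Neg).

## Load-bearing analysis (section `LoadBearing`)

* `dasGapTwelve_false_without_constant : ¬ DasGapTwelveWithoutConstant` — with `c₀` replaced by
  `1` the statement is FALSE (and `not_equivalent_without_constant`: NO pinned pair is equivalent;
  strict pointwise comparison `x^(-3/4) < x^(-11/12)` on `(0,1)` ⇒ `value r' < value r`).
  Moral: the chain must manufacture the irrational algebraic factor `c₀` (`c₀^4 = 9 + 6√3`,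
  root of `T^8 − 18T^4 − 27`, degree ≤ 8 over `ℚ`);
  inside the rules this is done by rule-2 scalings `x ↦ λx` with algebraic `λ`
  (graph `{y^4 = 2x^4, xy ≥ 0}` etc.), never by rules 1/3 alone.

* FAMILY version (section `Scaled`): `DasGapTwelveScaled c` = the crux with `c₀` replaced by a
  real parameter `c` (anchor `dasGapTwelve_iff_scaled : DasGapTwelve ↔ DasGapTwelveScaled c₀`,
  `Iff.rfl`); `not_equivalent_of_le_one`: for EVERY real `c ≤ 1` no pinned pair is equivalent
  (`value r' = c·∫kernel ≤ ∫kernel < value r`), `not_dasGapTwelveScaled_one : ¬ DasGapTwelveScaled 1`.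
  (For transcendental `c` the member is vacuously true — no `ℚ`-semialgebraic `r'` exists — so a
  `¬` is only claimed where a witness exists.)  Not attempted: the upper range `c ≥ 9`, which needs
  quantitative enclosures `B(1/12,1/4) ≤ 12·2^(2/3)+4·2^(2/3)`, `B(1/4,1/4) ≥ 4^(3/4)` — true but
  uninformative for provers.

## Tightness (sections `Tightness`, `Irrational`)

* `constant_unique` / `constant_forced`: at most one real constant makes the scaled pair
  equivalent; under the crux it is `c₀` (and `irrational_c₀`, `no_rational_constant`: no RATIONAL
  rescaling can ever work — every chain performs an irrational algebraic rescaling) — e.g. the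
  real root `1.086… = 2^(-1/4)3^(3/8)√(√3−1)` of the COMPANION factor `T^8 + 18T^4 − 27` of
  `(T^8−189)² − 34992 = (T^8−18T^4−27)(T^8+18T^4−27)` (same `W² = 34992`, opposite sign of `W`; it is
  not a Galois conjugate of `c₀`) is excluded.
  The crux's `Real.sqrt` pins the right real root; a prover's semialgebraic description of `c₀`
  MUST carry the sign condition `W > 0` (see `c₀_graph_iff`).

## The lattice certificate behind the word "gap" (namespace `Lattice12`)

Dictionary (heuristic, NOT a theorem about `KZ.relations`): `[j/12] ↦ Γ(j/12)`,
`B(a,b) ↦ [a]+[b]−[a+b]`; reflections `[x]+[−x]` and Gauss multiplications `Σ_k [x+k/m] − [mx]`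
generate the standard relations `S₁₂`.  Machine-checked here (`decide`): the gap class
`a = [1/12]−[1/4]−[1/3]` and the crux's Beta-pair class are NOT in `S₁₂` (parity functional
`χ = m₁+m₅+m₇+m₁₁ mod 2` kills every generator, `χ(a) = 1`), while `2a ∈ S₁₂` explicitly
(`two_smul_gapClass_mem_standardSpan`).  Independently recomputed in `num/gap_f2.py` (evidence on
the item) for ALL levels `N' = 12k ≤ 360`: an `F₂` certificate exists at every level (so
`a ∉ S_{N'} + 2ℤ^{N'} ⊇ S_{N'}` — unconditional in this direction; the test could only have been
INconclusive the other way); for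
`N' = 12p`, `p ≥ 5` prime, the same functional `{p,5p,7p,11p}` works.  Consequence for provers:
no bookkeeping with MultiplicationAccessible + EulerReflection + translation + BetaCancellation at
any level ≤ 360 reaches the pair; only its "square" is standard.  A proof must go through a
genuinely different correspondence (the CM isogeny `J(F₁₂)^{(1,3,8)} ~ E_i²`; both CM types are
`{1,5} ⊂ (ℤ/12)ˣ`, induced from `ℚ(i)`).

## Anchor in the route (section `Sector`)

* `dasGapTwelve_of_gammaHodgeSector : GammaHodgeSector → repB_1_12_1_4.value = repC₀B.value →
  DasGapTwelve` — the crux IS the `N = N' = 1, k = 0` instance of the route's crux 5 (data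
  `x = 1/12, y = 1/4, x' = y' = 1/4, c = c₀`; `isAlgebraic_c₀`, `hodge_condition` for every `u`
  coprime to 12), modulo the classical value identity, which is the only non-formal input.  The
  crux isolates no mechanism of its own; its content is the POSITION of the pair in the lattice
  (`Lattice12`: outside the standard span, its double inside).  Structure of any proof, read off
  from `two_smul_gapClass_mem_standardSpan`: given MultiplicationAccessible + EulerReflection +
  BetaCancellation the SQUARED pair (dimension-2 products `r ⊗ r ~ c₀² · r' ⊗ r'`) is reachable by
  standard bookkeeping; what no rule supplies is the square-root extraction
  `r ⊗ r ~ r' ⊗ r' ⟹ r ~ r'` — the CM isogeny is one way to realise it.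
  LINK TO ROUTE Neg (crux `CancellationGap`, stmt-KontsevichZagierPeriods-11011, whose docstring
  lists "Das-type square roots untested"): modulo the product/commutativity relations of
  KZProductIdeal, `[r⊗r] − [r'⊗r'] ≡ ([r] − [r'])·([r] + [r'])`; so IF the squared pair is reachable
  (cruxes 3 + reflection + 4 of this route) and `DasGapTwelve` FAILS, then `s = r ⊔ r'` (value
  `B(1/12,1/4) + c₀B(1/4,1/4) ≈ 31.13 ≠ 0`) is a zero-divisor on `[r] − [r']`, i.e. an explicit
  instance of `CancellationGap` (hence ¬summit).  Equivalently, `DasGapTwelve` = squared identity +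
  cancellation of the NON-Beta class `[r] + [r']` (not covered by `BetaCancellation`, which cancels
  Beta kernels only).  This is the sharpest statement of what the crux adds to the route.

LITERATURE ANCHOR (found this session): the gap class is, modulo `S₁₂`, ANDERSON'S CANONICAL BASIS
ELEMENT `a_{2·3} = [1/4] − [5/12] − [1/3]` of the 2-torsion of the universal odd distribution
(`gapClass_sub_andersonClass_mem`; Anderson, "Kronecker–Weber plus epsilon", Duke 2002 =
arXiv:math/0103241, Introduction, where `Γ(a_{2·3}) = Γ(5/12)Γ(1/3)/(√(2π)Γ(1/4)) =
2^(-1/4)3^(1/8)√(sin a_{2·3})` is displayed; this number is `3^(1/4)/c₀`).  So the crux's pair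
is literally the `{2,3}` member of the Kubert–Das–Anderson torsion basis: "smallest gap" is not an
artefact of the planner's enumeration.  Das 2000 (acq-01271) and Seo 2002 (acq-04675) are
paywalled; Anderson's introduction summarises both.

## Landed through the gate (importable by ideators / planners / provers)
* `Summits.KontsevichZagierPeriods.KontsevichZagierPeriods.Theorems.DasGapTwelve.Negative.Lattice12`
  (p73751): the level-12 lattice certificate incl. Anderson's class.
* `Summits.KontsevichZagierPeriods.KontsevichZagierPeriods.Theorems.DasGapTwelve.Negative.LoadBearing`
  (p75042): kit, `c₀` algebra (`c₀_pow_four`, `c₀_pow_eight`, `irrational_c₀`, `isAlgebraic_c₀`),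
  `hodge_condition`, `DasGapTwelveScaled` + anchor, `not_equivalent_without_constant`,
  `not_equivalent_of_le_one`, `constant_unique`.
* `…Theorems.DasGapTwelve.Negative.Witness` (filed after LoadBearing): `betaRep`, `repB_1_12_1_4`,
  `repB_1_4_1_4`, `repC₀B`, `dasGapTwelve_iff_instance`, the literal `¬` statements,
  `constant_forced`, `no_rational_constant`, `dasGapTwelve_of_gammaHodgeSector`.
(Namespace there: `Summit.KontsevichZagierPeriods.TerasomaMultiplication.DasGapTwelveNegative`.)

## Targets
None yet (payload `stuck_stubs = []`).

## Dead ends (one line each)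
* evaluation kill — values agree exactly (above);
* vacuity / junk inhabitant — both representations exist (`repB_1_12_1_4`, `repC₀B`);
* off-domain integrand junk — irrelevant (`KZ.of_sub_of_mem_relations_of_eqOn`);
* negatives index — 1 unrelated entry (KinematicFormulas convexity);
* companion-root constant `1.086…` — excluded by `Real.sqrt` / the sign of `W` (tightness above).
-/

noncomputable section

set_option linter.dupNamespace false

namespace Summit.KontsevichZagierPeriods.KontsevichZagierPeriods.Cruxes.DasGapTwelve.Disproof

open MeasureTheory Set
open Literature.NumberTheory.Transcendental

/-! ## The domain `(0,1) ⊂ ℝ¹` -/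

/-- The open unit interval as a subset of `ℝ¹` (the pinned domain of both representations). -/
abbrev unitIoo : Set (Fin 1 → ℝ) := {x | x 0 ∈ Set.Ioo (0:ℝ) 1}

theorem measurableSet_unitIoo : MeasurableSet unitIoo :=
  measurableSet_Ioo.preimage (measurable_pi_apply 0)

theorem isOpen_unitIoo : IsOpen unitIoo := isOpen_Ioo.preimage (continuous_apply 0)

theorem volume_unitIoo_pos : 0 < volume unitIoo := by
  refine isOpen_unitIoo.measure_pos volume ⟨fun _ => 1/2, ?_⟩
  simp only [unitIoo, Set.mem_setOf_eq, Set.mem_Ioo]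
  norm_num

/-! ## Witness representations: Beta integrands with rational exponents on `(0,1)` -/
section Witness

/-- For `u > 0`: `u ^ p = u ^ p⁺ / u ^ p⁻` with `p⁺ = p.toNat`, `p⁻ = (-p).toNat`. -/
theorem zpow_eq_pow_div_pow {u : ℝ} (hu : u ≠ 0) (p : ℤ) :
    u ^ p = u ^ p.toNat / u ^ (-p).toNat := by
  conv_lhs => rw [← Int.toNat_sub_toNat_neg p]
  rw [zpow_sub₀ hu, zpow_natCast, zpow_natCast]

/-- `(t^(p/q))^q = t^p` for `t ≥ 0`... stated for `0 < t`. -/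
theorem rpow_div_pow_eq_zpow {t : ℝ} (ht : 0 < t) (p : ℤ) {q : ℕ} (hq : q ≠ 0) :
    (t ^ ((p : ℝ) / q)) ^ q = t ^ p := by
  rw [← Real.rpow_natCast, ← Real.rpow_mul ht.le, div_mul_cancel₀ _ (by exact_mod_cast hq),
    Real.rpow_intCast]

/-- The graph of `t ↦ t^(p/q) (1-t)^(p'/q)` over `(0,1)` is cut out by one polynomial equation
and a sign condition. -/
theorem rpow_graph_iff {t y : ℝ} (ht : t ∈ Set.Ioo (0:ℝ) 1) (p p' : ℤ) {q : ℕ} (hq : q ≠ 0) :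
    y = t ^ ((p : ℝ) / q) * (1 - t) ^ ((p' : ℝ) / q) ↔
      0 < y ∧ y ^ q * (t ^ (-p).toNat * (1 - t) ^ (-p').toNat) =
        t ^ p.toNat * (1 - t) ^ p'.toNat := by
  have ht0 : 0 < t := ht.1
  have ht1 : 0 < 1 - t := sub_pos.mpr ht.2
  set f : ℝ := t ^ ((p : ℝ) / q) * (1 - t) ^ ((p' : ℝ) / q) with hf
  have hfpos : 0 < f := mul_pos (Real.rpow_pos_of_pos ht0 _) (Real.rpow_pos_of_pos ht1 _)
  have hfq : f ^ q = t ^ p * (1 - t) ^ p' := by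
    rw [hf, mul_pow, rpow_div_pow_eq_zpow ht0 p hq, rpow_div_pow_eq_zpow ht1 p' hq]
  have hden : t ^ (-p).toNat * (1 - t) ^ (-p').toNat ≠ 0 :=
    mul_ne_zero (pow_ne_zero _ ht0.ne') (pow_ne_zero _ ht1.ne')
  have hfq' : f ^ q * (t ^ (-p).toNat * (1 - t) ^ (-p').toNat) =
      t ^ p.toNat * (1 - t) ^ p'.toNat := by
    rw [hfq, zpow_eq_pow_div_pow ht0.ne', zpow_eq_pow_div_pow ht1.ne']
    field_simp
  constructor
  · rintro rfl
    exact ⟨hfpos, hfq'⟩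
  · rintro ⟨hy, hyq⟩
    have : y ^ q = f ^ q := by
      apply mul_right_cancel₀ hden
      rw [hyq, hfq']
    exact (pow_left_inj₀ hy.le hfpos.le hq).mp this

/-- The polynomial `Y^q X^{p⁻} (1-X)^{p'⁻} - X^{p⁺} (1-X)^{p'⁺} ∈ ℚ[X,Y]` cutting out the graph. -/
def graphPoly (p p' : ℤ) (q : ℕ) : MvPolynomial (Fin 2) ℚ :=
  MvPolynomial.X 1 ^ q * (MvPolynomial.X 0 ^ (-p).toNat * (1 - MvPolynomial.X 0) ^ (-p').toNat) -
    MvPolynomial.X 0 ^ p.toNat * (1 - MvPolynomial.X 0) ^ p'.toNat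

theorem isSemialgebraic_unitIoo :
    Literature.ModelTheory.ExponentialFields.IsSemialgebraic ℚ unitIoo := by
  have h1 := Literature.ModelTheory.ExponentialFields.isSemialgebraic_setOf_eval_pos (R := ℝ)
    (MvPolynomial.X (R := ℚ) (0 : Fin 1))
  have h2 := Literature.ModelTheory.ExponentialFields.isSemialgebraic_setOf_eval_pos (R := ℝ)
    (1 - MvPolynomial.X (R := ℚ) (0 : Fin 1))
  convert h1.inter h2 using 1
  ext x
  simp [sub_pos]

/-- Beta integrands with rational exponents are `ℚ`-semialgebraic functions on `(0,1)`. -/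
theorem isSemialgebraicFunOn_rpow_mul_rpow (p p' : ℤ) {q : ℕ} (hq : q ≠ 0) :
    IsSemialgebraicFunOn ℚ unitIoo
      (fun x => (x 0) ^ ((p : ℝ) / q) * (1 - x 0) ^ ((p' : ℝ) / q)) := by
  rw [isSemialgebraicFunOn_iff]
  have hS :
      {z : Fin (1 + 1) → ℝ | Fin.init z ∈ unitIoo ∧
          z (Fin.last 1) = (Fin.init z 0) ^ ((p : ℝ) / q) * (1 - Fin.init z 0) ^ ((p' : ℝ) / q)} =
        ({z : Fin 2 → ℝ | 0 < MvPolynomial.aeval z (MvPolynomial.X (R := ℚ) (0 : Fin 2))} ∩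
          {z | 0 < MvPolynomial.aeval z (1 - MvPolynomial.X (R := ℚ) (0 : Fin 2))}) ∩
        ({z | 0 < MvPolynomial.aeval z (MvPolynomial.X (R := ℚ) (1 : Fin 2))} ∩
          {z | MvPolynomial.aeval z (graphPoly p p' q) = 0}) := by
    ext z
    simp only [Set.mem_setOf_eq, Set.mem_inter_iff, Set.mem_Ioo, graphPoly, map_sub, map_mul,
      map_pow, map_one, MvPolynomial.aeval_X, sub_pos, sub_eq_zero]
    have e0 : Fin.init z 0 = z 0 := rfl
    have e1 : z (Fin.last 1) = z 1 := rfl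
    rw [e0, e1]
    constructor
    · rintro ⟨hz, hy⟩
      exact ⟨hz, (rpow_graph_iff hz p p' hq).mp hy⟩
    · rintro ⟨hz, hy⟩
      exact ⟨hz, (rpow_graph_iff hz p p' hq).mpr hy⟩
  rw [hS]
  exact ((Literature.ModelTheory.ExponentialFields.isSemialgebraic_setOf_eval_pos _).inter
    (Literature.ModelTheory.ExponentialFields.isSemialgebraic_setOf_eval_pos _)).inter
    ((Literature.ModelTheory.ExponentialFields.isSemialgebraic_setOf_eval_pos _).inter
    (Literature.ModelTheory.ExponentialFields.isSemialgebraic_setOf_eval_eq_zero _))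

/-- Absolute convergence of the real Beta integral on `(0,1)` for exponents `> -1`
(from Mathlib's `Complex.betaIntegral_convergent` by taking norms). -/
theorem integrableOn_rpow_mul_rpow_Ioo {α β : ℝ} (hα : -1 < α) (hβ : -1 < β) :
    IntegrableOn (fun t : ℝ => t ^ α * (1 - t) ^ β) (Set.Ioo (0:ℝ) 1) := by
  have h := Complex.betaIntegral_convergent (u := ((α + 1 : ℝ) : ℂ)) (v := ((β + 1 : ℝ) : ℂ))
    (by simp only [Complex.ofReal_re]; linarith) (by simp only [Complex.ofReal_re]; linarith)
  rw [intervalIntegrable_iff_integrableOn_Ioo_of_le zero_le_one] at h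
  have hcont : ContinuousOn (fun t : ℝ => t ^ α * (1 - t) ^ β) (Set.Ioo (0:ℝ) 1) :=
    (continuousOn_id.rpow_const fun t ht => Or.inl ht.1.ne').mul
      ((continuousOn_const.sub continuousOn_id).rpow_const fun t ht => Or.inl (sub_pos.2 ht.2).ne')
  refine h.norm.mono' (hcont.aestronglyMeasurable measurableSet_Ioo) ?_
  filter_upwards [ae_restrict_mem measurableSet_Ioo] with t ht
  have ht1 : 0 < 1 - t := sub_pos.2 ht.2
  have e1 : (1 : ℂ) - (t : ℂ) = ((1 - t : ℝ) : ℂ) := by push_cast; ring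
  rw [e1]
  have hR : ‖(t : ℂ) ^ (((α + 1 : ℝ) : ℂ) - 1) * ((1 - t : ℝ) : ℂ) ^ (((β + 1 : ℝ) : ℂ) - 1)‖ =
      t ^ α * (1 - t) ^ β := by
    rw [norm_mul, Complex.norm_cpow_eq_rpow_re_of_pos ht.1, Complex.norm_cpow_eq_rpow_re_of_pos ht1]
    simp only [Complex.sub_re, Complex.ofReal_re, Complex.one_re, add_sub_cancel_right]
  rw [hR, Real.norm_eq_abs, abs_of_nonneg (mul_nonneg (Real.rpow_nonneg ht.1.le _)
    (Real.rpow_nonneg ht1.le _))]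

/-- The same on `ℝ¹ = Fin 1 → ℝ`. -/
theorem integrableOn_rpow_mul_rpow {α β : ℝ} (hα : -1 < α) (hβ : -1 < β) :
    IntegrableOn (fun x : Fin 1 → ℝ => (x 0) ^ α * (1 - x 0) ^ β) unitIoo := by
  have he := volume_preserving_funUnique (Fin 1) ℝ
  have := (he.integrableOn_comp_preimage (MeasurableEquiv.measurableEmbedding _)).mpr
    (integrableOn_rpow_mul_rpow_Ioo hα hβ)
  exact this

/-- **Witness**: the Beta representation `[∫_(0,1) t^(p/q) (1-t)^(p'/q) dt]` for `p, p' > -q`. -/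
def betaRep (p p' : ℤ) (q : ℕ) (hq : q ≠ 0) (hp : -(q : ℤ) < p) (hp' : -(q : ℤ) < p') :
    KZ.IntegralRep 1 where
  domain := unitIoo
  integrand := fun x => (x 0) ^ ((p : ℝ) / q) * (1 - x 0) ^ ((p' : ℝ) / q)
  isSemialgebraic_domain := isSemialgebraic_unitIoo
  isSemialgebraicFunOn_integrand := isSemialgebraicFunOn_rpow_mul_rpow p p' hq
  integrableOn := by
    have hq' : (0 : ℝ) < q := by exact_mod_cast Nat.pos_of_ne_zero hq
    refine integrableOn_rpow_mul_rpow ?_ ?_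
    · rw [lt_div_iff₀ hq', neg_one_mul]; exact_mod_cast hp
    · rw [lt_div_iff₀ hq', neg_one_mul]; exact_mod_cast hp'

/-- `B(1/12,1/4)`: `[∫_(0,1) t^(-11/12) (1-t)^(-3/4)]`. -/
def repB_1_12_1_4 : KZ.IntegralRep 1 := betaRep (-11) (-9) 12 (by norm_num) (by norm_num) (by norm_num)

/-- `B(1/4,1/4)`: `[∫_(0,1) t^(-3/4) (1-t)^(-3/4)]`. -/
def repB_1_4_1_4 : KZ.IntegralRep 1 := betaRep (-3) (-3) 4 (by norm_num) (by norm_num) (by norm_num)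

theorem repB_1_12_1_4_eqOn : Set.EqOn repB_1_12_1_4.integrand
    (fun x => (x 0) ^ (-(11:ℝ)/12) * (1 - x 0) ^ (-(3:ℝ)/4)) repB_1_12_1_4.domain := by
  intro x _
  simp only [repB_1_12_1_4, betaRep]
  norm_num

theorem repB_1_4_1_4_eqOn : Set.EqOn repB_1_4_1_4.integrand
    (fun x => (x 0) ^ (-(3:ℝ)/4) * (1 - x 0) ^ (-(3:ℝ)/4)) repB_1_4_1_4.domain := by
  intro x _
  simp only [repB_1_4_1_4, betaRep]
  norm_num

end Witness

/-! ## The algebraic constant `c₀` and a witness for the crux's second representation -/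
section Constant

/-- `c₀ = 2^(-1/4) · 3^(3/8) · √(1+√3) = 2.0984921908…` (syntactically the crux's prefix). -/
def c₀ : ℝ := (2:ℝ) ^ (-(1:ℝ)/4) * (3:ℝ) ^ ((3:ℝ)/8) * Real.sqrt (1 + Real.sqrt 3)

theorem c₀_pos : 0 < c₀ := by unfold c₀; positivity

/-- `c₀^4 = 9 + 6√3`: `(2^(-1/4))^4 · (3^(3/8))^4 · √(1+√3)^4 = (1/2)·3√3·(4+2√3)`.  Hence `c₀` is a
root of `T^8 - 18T^4 - 27` (degree ≤ 8 over `ℚ`; `9 + 6√3` is not a square in `ℚ(√3)`). -/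
theorem c₀_pow_four : c₀ ^ 4 = 9 + 6 * Real.sqrt 3 := by
  unfold c₀
  have h2 : ((2:ℝ) ^ (-(1:ℝ)/4)) ^ 4 = 1/2 := by
    rw [← Real.rpow_natCast, ← Real.rpow_mul (by norm_num : (0:ℝ) ≤ 2)]
    rw [show (-(1:ℝ)/4) * ((4:ℕ):ℝ) = ((-1:ℤ):ℝ) by norm_num, Real.rpow_intCast]
    norm_num
  have h3 : ((3:ℝ) ^ ((3:ℝ)/8)) ^ 4 = 3 * Real.sqrt 3 := by
    rw [← Real.rpow_natCast, ← Real.rpow_mul (by norm_num : (0:ℝ) ≤ 3)]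
    rw [show ((3:ℝ)/8) * ((4:ℕ):ℝ) = 1 + 1/2 by norm_num, Real.rpow_add (by norm_num : (0:ℝ) < 3),
      Real.rpow_one, Real.sqrt_eq_rpow]
  have h1 : 0 ≤ 1 + Real.sqrt 3 := by positivity
  have h4 : Real.sqrt (1 + Real.sqrt 3) ^ 4 = 4 + 2 * Real.sqrt 3 := by
    rw [show 4 = 2 * 2 by norm_num, pow_mul, Real.sq_sqrt h1]
    linear_combination Real.sq_sqrt (show (0:ℝ) ≤ 3 by norm_num)
  rw [mul_pow, mul_pow, h2, h3, h4]
  linear_combination (3:ℝ) * Real.sq_sqrt (show (0:ℝ) ≤ 3 by norm_num)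

/-- `c₀^8 = 189 + 108√3 = 27(2+√3)²` (the square of `c₀_pow_four`; so `c₀` is a root of
`T^8 - 18T^4 - 27` and has degree ≤ 8 over `ℚ`). -/
theorem c₀_pow_eight : c₀ ^ 8 = 189 + 108 * Real.sqrt 3 := by
  unfold c₀
  have h2 : ((2:ℝ) ^ (-(1:ℝ)/4)) ^ 8 = 1/4 := by
    rw [← Real.rpow_natCast, ← Real.rpow_mul (by norm_num : (0:ℝ) ≤ 2)]
    rw [show (-(1:ℝ)/4) * ((8:ℕ):ℝ) = ((-2:ℤ):ℝ) by norm_num, Real.rpow_intCast]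
    norm_num
  have h3 : ((3:ℝ) ^ ((3:ℝ)/8)) ^ 8 = 27 := by
    rw [← Real.rpow_natCast, ← Real.rpow_mul (by norm_num : (0:ℝ) ≤ 3)]
    rw [show ((3:ℝ)/8) * ((8:ℕ):ℝ) = ((3:ℕ):ℝ) by norm_num, Real.rpow_natCast]
    norm_num
  have h1 : 0 ≤ 1 + Real.sqrt 3 := by positivity
  have hsq : (1 + Real.sqrt 3) ^ 2 = 4 + 2 * Real.sqrt 3 := by
    linear_combination Real.sq_sqrt (show (0:ℝ) ≤ 3 by norm_num)
  have h4 : Real.sqrt (1 + Real.sqrt 3) ^ 8 = 28 + 16 * Real.sqrt 3 := by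
    rw [show 8 = 2 * (2 * 2) by norm_num, pow_mul, Real.sq_sqrt h1, pow_mul, hsq]
    linear_combination (4:ℝ) * Real.sq_sqrt (show (0:ℝ) ≤ 3 by norm_num)
  rw [mul_pow, mul_pow, h2, h3, h4]
  ring

theorem c₀_pow_eight_sub_sq : (c₀ ^ 8 - 189) ^ 2 = 34992 := by
  rw [c₀_pow_eight]; linear_combination (11664:ℝ) * Real.sq_sqrt (show (0:ℝ) ≤ 3 by norm_num)

theorem c₀_pow_eight_gt : 189 < c₀ ^ 8 := by
  rw [c₀_pow_eight]; have := Real.sqrt_pos.mpr (show (0:ℝ) < 3 by norm_num); linarith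

/-- `(t^(-3/4) (1-t)^(-3/4))^8 · t^6 (1-t)^6 = 1` on `(0,1)`. -/
theorem kernel_pow_eight {t : ℝ} (ht : t ∈ Set.Ioo (0:ℝ) 1) :
    (t ^ (-(3:ℝ)/4) * (1 - t) ^ (-(3:ℝ)/4)) ^ 8 * (t ^ 6 * (1 - t) ^ 6) = 1 := by
  have ht0 : 0 < t := ht.1
  have ht1 : 0 < 1 - t := sub_pos.mpr ht.2
  have e : ∀ u : ℝ, 0 < u → (u ^ (-(3:ℝ)/4)) ^ 8 = (u ^ 6)⁻¹ := fun u hu => by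
    rw [← Real.rpow_natCast, ← Real.rpow_mul hu.le,
      show (-(3:ℝ)/4) * ((8:ℕ):ℝ) = ((-6:ℤ):ℝ) by norm_num, Real.rpow_intCast, zpow_neg, zpow_ofNat]
  rw [mul_pow, e t ht0, e (1 - t) ht1]
  field_simp

/-- The graph of `t ↦ c₀ t^(-3/4)(1-t)^(-3/4)` over `(0,1)`, cut out over `ℚ`. -/
theorem c₀_graph_iff {t y : ℝ} (ht : t ∈ Set.Ioo (0:ℝ) 1) :
    y = c₀ * t ^ (-(3:ℝ)/4) * (1 - t) ^ (-(3:ℝ)/4) ↔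
      0 < y ∧ 0 < y ^ 8 * (t ^ 6 * (1 - t) ^ 6) - 189 ∧
        (y ^ 8 * (t ^ 6 * (1 - t) ^ 6) - 189) ^ 2 - 34992 = 0 := by
  have ht0 : 0 < t := ht.1
  have ht1 : 0 < 1 - t := sub_pos.mpr ht.2
  set g : ℝ := t ^ (-(3:ℝ)/4) * (1 - t) ^ (-(3:ℝ)/4) with hg
  have hgpos : 0 < g := mul_pos (Real.rpow_pos_of_pos ht0 _) (Real.rpow_pos_of_pos ht1 _)
  have hg8 : g ^ 8 * (t ^ 6 * (1 - t) ^ 6) = 1 := kernel_pow_eight ht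
  have hcg : (c₀ * g) ^ 8 * (t ^ 6 * (1 - t) ^ 6) = c₀ ^ 8 := by
    rw [mul_pow, mul_assoc, hg8, mul_one]
  constructor
  · intro hy
    have hy' : y = c₀ * g := by rw [hy, hg, mul_assoc]
    subst hy'
    refine ⟨mul_pos c₀_pos hgpos, ?_, ?_⟩
    · rw [hcg, sub_pos]; exact c₀_pow_eight_gt
    · rw [hcg, c₀_pow_eight_sub_sq]; ring
  · rintro ⟨hy, hpos, hsq⟩
    have hw : y ^ 8 * (t ^ 6 * (1 - t) ^ 6) - 189 = c₀ ^ 8 - 189 := by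
      have h1 : (y ^ 8 * (t ^ 6 * (1 - t) ^ 6) - 189) ^ 2 = (c₀ ^ 8 - 189) ^ 2 := by
        rw [c₀_pow_eight_sub_sq]; linarith
      exact (pow_left_inj₀ hpos.le (sub_pos.mpr c₀_pow_eight_gt).le two_ne_zero).mp h1
    have hy8 : y ^ 8 = (c₀ * g) ^ 8 := by
      have h2 : y ^ 8 * (t ^ 6 * (1 - t) ^ 6) = (c₀ * g) ^ 8 * (t ^ 6 * (1 - t) ^ 6) := by
        rw [hcg]; linarith
      exact mul_right_cancel₀ (mul_ne_zero (pow_ne_zero _ ht0.ne') (pow_ne_zero _ ht1.ne')) h2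
    have : y = c₀ * g :=
      (pow_left_inj₀ hy.le (mul_pos c₀_pos hgpos).le (by norm_num : (8:ℕ) ≠ 0)).mp hy8
    rw [this, hg, mul_assoc]

/-- The `ℚ`-polynomial `W = Y^8 X^6 (1-X)^6 - 189`. -/
def wPoly : MvPolynomial (Fin 2) ℚ :=
  MvPolynomial.X 1 ^ 8 * (MvPolynomial.X 0 ^ 6 * (1 - MvPolynomial.X 0) ^ 6) - 189

theorem isSemialgebraicFunOn_c₀_mul :
    IsSemialgebraicFunOn ℚ unitIoo
      (fun x => c₀ * (x 0) ^ (-(3:ℝ)/4) * (1 - x 0) ^ (-(3:ℝ)/4)) := by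
  rw [isSemialgebraicFunOn_iff]
  have hS :
      {z : Fin (1 + 1) → ℝ | Fin.init z ∈ unitIoo ∧
          z (Fin.last 1) = c₀ * (Fin.init z 0) ^ (-(3:ℝ)/4) * (1 - Fin.init z 0) ^ (-(3:ℝ)/4)} =
        ({z : Fin 2 → ℝ | 0 < MvPolynomial.aeval z (MvPolynomial.X (R := ℚ) (0 : Fin 2))} ∩
          {z | 0 < MvPolynomial.aeval z (1 - MvPolynomial.X (R := ℚ) (0 : Fin 2))}) ∩
        ({z | 0 < MvPolynomial.aeval z (MvPolynomial.X (R := ℚ) (1 : Fin 2))} ∩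
          ({z | 0 < MvPolynomial.aeval z wPoly} ∩
            {z | MvPolynomial.aeval z (wPoly ^ 2 - 34992) = 0})) := by
    ext z
    simp only [Set.mem_setOf_eq, Set.mem_inter_iff, Set.mem_Ioo, wPoly, map_sub, map_mul,
      map_pow, map_one, map_ofNat, MvPolynomial.aeval_X, sub_pos]
    have e0 : Fin.init z 0 = z 0 := rfl
    have e1 : z (Fin.last 1) = z 1 := rfl
    rw [e0, e1]
    constructor
    · rintro ⟨hz, hy⟩
      obtain ⟨h1, h2, h3⟩ := (c₀_graph_iff hz).mp hy
      exact ⟨hz, h1, sub_pos.mp h2, h3⟩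
    · rintro ⟨hz, h1, h2, h3⟩
      exact ⟨hz, (c₀_graph_iff hz).mpr ⟨h1, sub_pos.mpr h2, h3⟩⟩
  rw [hS]
  exact ((Literature.ModelTheory.ExponentialFields.isSemialgebraic_setOf_eval_pos _).inter
    (Literature.ModelTheory.ExponentialFields.isSemialgebraic_setOf_eval_pos _)).inter
    ((Literature.ModelTheory.ExponentialFields.isSemialgebraic_setOf_eval_pos _).inter
    ((Literature.ModelTheory.ExponentialFields.isSemialgebraic_setOf_eval_pos _).inter
    (Literature.ModelTheory.ExponentialFields.isSemialgebraic_setOf_eval_eq_zero _)))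

/-- **Witness** for the crux's second representation: `[∫_(0,1) c₀ t^(-3/4)(1-t)^(-3/4)]`,
with integrand SYNTACTICALLY the crux's. Hence `DasGapTwelve` is not vacuous. -/
def repC₀B : KZ.IntegralRep 1 where
  domain := unitIoo
  integrand := fun x => c₀ * (x 0) ^ (-(3:ℝ)/4) * (1 - x 0) ^ (-(3:ℝ)/4)
  isSemialgebraic_domain := isSemialgebraic_unitIoo
  isSemialgebraicFunOn_integrand := isSemialgebraicFunOn_c₀_mul
  integrableOn := by
    have h : IntegrableOn (fun x : Fin 1 → ℝ => c₀ * ((x 0) ^ (-(3:ℝ)/4) * (1 - x 0) ^ (-(3:ℝ)/4)))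
        unitIoo :=
      (integrableOn_rpow_mul_rpow (α := -(3:ℝ)/4) (β := -(3:ℝ)/4) (by norm_num) (by norm_num)).const_mul c₀
    exact IntegrableOn.congr_fun h (fun x _ => (mul_assoc _ _ _).symm) measurableSet_unitIoo

theorem repC₀B_eqOn : Set.EqOn repC₀B.integrand
    (fun x => (2:ℝ) ^ (-(1:ℝ)/4) * (3:ℝ) ^ ((3:ℝ)/8) * Real.sqrt (1 + Real.sqrt 3) *
      (x 0) ^ (-(3:ℝ)/4) * (1 - x 0) ^ (-(3:ℝ)/4)) repC₀B.domain := fun _ _ => rfl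

/-- **The crux is one concrete equivalence** (pinned representations differ by relations:
integrand additivity with a zero representation, `KZ.of_sub_of_mem_relations_of_eqOn`). -/
theorem dasGapTwelve_iff_instance :
    Theses.TerasomaMultiplication.DasGapTwelve ↔ KZ.Equivalent repB_1_12_1_4 repC₀B := by
  constructor
  · intro h
    exact h _ _ rfl repB_1_12_1_4_eqOn rfl repC₀B_eqOn
  · intro h r r' hd hi hd' hi'
    have h1 : KZ.of r - KZ.of repB_1_12_1_4 ∈ KZ.relations :=
      KZ.of_sub_of_mem_relations_of_eqOn (by rw [hd]; rfl) fun x hx => by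
        rw [hi hx]
        exact (repB_1_12_1_4_eqOn (show x ∈ unitIoo by rw [hd] at hx; exact hx)).symm
    have h3 : KZ.of repC₀B - KZ.of r' ∈ KZ.relations :=
      KZ.of_sub_of_mem_relations_of_eqOn (by rw [hd']; rfl) fun x hx => by
        rw [repC₀B_eqOn hx]
        exact (hi' (show x ∈ r'.domain by rw [hd']; exact hx)).symm
    have := KZ.relations.add_mem (KZ.relations.add_mem h1 h) h3
    unfold KZ.Equivalent at this ⊢
    convert this using 1
    abel

end Constant

/-! ## Load-bearing analysis: the constant `c₀` cannot be dropped -/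
section LoadBearing

/-- The crux with the algebraic constant `c₀ = 2^(-1/4)3^(3/8)√(1+√3)` DROPPED (replaced by 1):
`B(1/12,1/4) ~ B(1/4,1/4)`.  FALSE: `dasGapTwelve_false_without_constant`. -/
def DasGapTwelveWithoutConstant : Prop :=
  ∀ (r r' : KZ.IntegralRep 1), r.domain = {x | x 0 ∈ Set.Ioo (0:ℝ) 1} →
    Set.EqOn r.integrand (fun x => (x 0) ^ (-(11:ℝ)/12) * (1 - x 0) ^ (-(3:ℝ)/4)) r.domain →
    r'.domain = {x | x 0 ∈ Set.Ioo (0:ℝ) 1} →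
    Set.EqOn r'.integrand (fun x => (x 0) ^ (-(3:ℝ)/4) * (1 - x 0) ^ (-(3:ℝ)/4)) r'.domain →
    KZ.Equivalent r r'

/-- Pointwise strict comparison of the two Beta integrands on `(0,1)` once `c₀` is dropped. -/
theorem integrand_lt {t : ℝ} (ht : t ∈ Set.Ioo (0:ℝ) 1) :
    t ^ (-(3:ℝ)/4) * (1 - t) ^ (-(3:ℝ)/4) < t ^ (-(11:ℝ)/12) * (1 - t) ^ (-(3:ℝ)/4) := by
  have h1 : 0 < (1 - t) ^ (-(3:ℝ)/4) := Real.rpow_pos_of_pos (by linarith [ht.2]) _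
  have h2 : t ^ (-(3:ℝ)/4) < t ^ (-(11:ℝ)/12) :=
    Real.rpow_lt_rpow_of_exponent_gt ht.1 ht.2 (by norm_num)
  exact mul_lt_mul_of_pos_right h2 h1

/-- Without the constant the values differ: `B(1/4,1/4) < B(1/12,1/4)` for ANY pinned pair
(integrability is carried by the representations themselves). -/
theorem value_lt_value_without_constant (r r' : KZ.IntegralRep 1)
    (hd : r.domain = {x | x 0 ∈ Set.Ioo (0:ℝ) 1})
    (hi : Set.EqOn r.integrand (fun x => (x 0) ^ (-(11:ℝ)/12) * (1 - x 0) ^ (-(3:ℝ)/4)) r.domain)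
    (hd' : r'.domain = {x | x 0 ∈ Set.Ioo (0:ℝ) 1})
    (hi' : Set.EqOn r'.integrand (fun x => (x 0) ^ (-(3:ℝ)/4) * (1 - x 0) ^ (-(3:ℝ)/4)) r'.domain) :
    r'.value < r.value := by
  have hr : IntegrableOn r.integrand unitIoo := by
    have h := r.integrableOn; rw [hd] at h; exact h
  have hr' : IntegrableOn r'.integrand unitIoo := by
    have h := r'.integrableOn; rw [hd'] at h; exact h
  rw [← sub_pos]
  unfold KZ.IntegralRep.value
  rw [hd, hd', ← integral_sub hr hr']
  refine (setIntegral_pos_iff_support_of_nonneg_ae ?_ (hr.sub hr')).mpr ?_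
  · refine ae_restrict_of_forall_mem measurableSet_unitIoo fun x hx => ?_
    have hx1 : x ∈ r.domain := by rw [hd]; exact hx
    have hx2 : x ∈ r'.domain := by rw [hd']; exact hx
    simp only [Pi.zero_apply, Pi.sub_apply]
    rw [hi hx1, hi' hx2]
    exact (sub_pos.mpr (integrand_lt hx)).le
  · have hsupp : Function.support (r.integrand - r'.integrand) ∩ unitIoo = unitIoo := by
      refine Set.inter_eq_right.mpr fun x hx => ?_
      rw [Function.mem_support, Pi.sub_apply]
      have hx1 : x ∈ r.domain := by rw [hd]; exact hx
      have hx2 : x ∈ r'.domain := by rw [hd']; exact hx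
      rw [hi hx1, hi' hx2]
      exact (sub_pos.mpr (integrand_lt hx)).ne'
    rw [hsupp]
    exact volume_unitIoo_pos

/-- **Any proof must use the constant**: with `c₀` dropped, NO pinned pair is KZ-equivalent
(soundness `KZ.Equivalent.value_eq_holds` + `value_lt_value_without_constant`). -/
theorem not_equivalent_without_constant (r r' : KZ.IntegralRep 1)
    (hd : r.domain = {x | x 0 ∈ Set.Ioo (0:ℝ) 1})
    (hi : Set.EqOn r.integrand (fun x => (x 0) ^ (-(11:ℝ)/12) * (1 - x 0) ^ (-(3:ℝ)/4)) r.domain)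
    (hd' : r'.domain = {x | x 0 ∈ Set.Ioo (0:ℝ) 1})
    (hi' : Set.EqOn r'.integrand (fun x => (x 0) ^ (-(3:ℝ)/4) * (1 - x 0) ^ (-(3:ℝ)/4)) r'.domain) :
    ¬ KZ.Equivalent r r' := fun h =>
  (value_lt_value_without_constant r r' hd hi hd' hi').ne' (KZ.Equivalent.value_eq_holds h)


/-- **`¬ DasGapTwelveWithoutConstant`** — the literal refutation of the constant-free variant,
instantiated at the witnesses `repB_1_12_1_4`, `repB_1_4_1_4`. -/
theorem dasGapTwelve_false_without_constant : ¬ DasGapTwelveWithoutConstant := fun h =>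
  not_equivalent_without_constant repB_1_12_1_4 repB_1_4_1_4 rfl repB_1_12_1_4_eqOn rfl
    repB_1_4_1_4_eqOn (h _ _ rfl repB_1_12_1_4_eqOn rfl repB_1_4_1_4_eqOn)

end LoadBearing

/-! ## Tightness: the constant is unique -/
section Tightness

/-- A pinned `B(1/12,1/4)` representation has positive value. -/
theorem value_pos_of_pinned (r : KZ.IntegralRep 1) (hd : r.domain = {x | x 0 ∈ Set.Ioo (0:ℝ) 1})
    (hi : Set.EqOn r.integrand (fun x => (x 0) ^ (-(11:ℝ)/12) * (1 - x 0) ^ (-(3:ℝ)/4)) r.domain) :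
    0 < r.value := by
  have hr : IntegrableOn r.integrand unitIoo := by
    have h := r.integrableOn; rw [hd] at h; exact h
  have hpos : ∀ x ∈ unitIoo, 0 < r.integrand x := fun x hx => by
    rw [hi (show x ∈ r.domain by rw [hd]; exact hx)]
    exact mul_pos (Real.rpow_pos_of_pos hx.1 _) (Real.rpow_pos_of_pos (sub_pos.2 hx.2) _)
  unfold KZ.IntegralRep.value
  rw [hd]
  refine (setIntegral_pos_iff_support_of_nonneg_ae ?_ hr).mpr ?_
  · exact ae_restrict_of_forall_mem measurableSet_unitIoo fun x hx => (hpos x hx).le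
  · have hsupp : Function.support r.integrand ∩ unitIoo = unitIoo :=
      Set.inter_eq_right.mpr fun x hx => Function.mem_support.mpr (hpos x hx).ne'
    rw [hsupp]
    exact volume_unitIoo_pos

/-- The value of a `c · B(1/4,1/4)`-pinned representation (no integrability needed: junk-safe). -/
theorem value_eq_const_mul (r' : KZ.IntegralRep 1) (c : ℝ)
    (hd' : r'.domain = {x | x 0 ∈ Set.Ioo (0:ℝ) 1})
    (hi' : Set.EqOn r'.integrand (fun x => c * (x 0) ^ (-(3:ℝ)/4) * (1 - x 0) ^ (-(3:ℝ)/4))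
      r'.domain) :
    r'.value = c * ∫ x in unitIoo, (x 0) ^ (-(3:ℝ)/4) * (1 - x 0) ^ (-(3:ℝ)/4) := by
  have hi'' : Set.EqOn r'.integrand (fun x => c * ((x 0) ^ (-(3:ℝ)/4) * (1 - x 0) ^ (-(3:ℝ)/4)))
      unitIoo := fun x hx =>
    (hi' (show x ∈ r'.domain by rw [hd']; exact hx)).trans (mul_assoc _ _ _)
  unfold KZ.IntegralRep.value
  rw [hd', setIntegral_congr_fun measurableSet_unitIoo hi'', integral_const_mul]

/-- **Tightness.** If the `B(1/12,1/4)` representation is equivalent both to a `c`-scaled and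
to a `c'`-scaled `B(1/4,1/4)` representation then `c = c'`: the constant of the crux cannot
be altered (in particular not replaced by the real root `2^(-1/4)3^(3/8)√(√3-1) = 1.086…` of the
companion factor `T^8 + 18T^4 - 27` of `(T^8-189)^2-34992`, which the sign-blind equation
`W² = 34992` of `c₀_graph_iff` would otherwise admit). -/
theorem constant_unique {c c' : ℝ} (r r₁ r₂ : KZ.IntegralRep 1)
    (hd : r.domain = {x | x 0 ∈ Set.Ioo (0:ℝ) 1})
    (hi : Set.EqOn r.integrand (fun x => (x 0) ^ (-(11:ℝ)/12) * (1 - x 0) ^ (-(3:ℝ)/4)) r.domain)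
    (hd₁ : r₁.domain = {x | x 0 ∈ Set.Ioo (0:ℝ) 1})
    (hi₁ : Set.EqOn r₁.integrand (fun x => c * (x 0) ^ (-(3:ℝ)/4) * (1 - x 0) ^ (-(3:ℝ)/4))
      r₁.domain)
    (hd₂ : r₂.domain = {x | x 0 ∈ Set.Ioo (0:ℝ) 1})
    (hi₂ : Set.EqOn r₂.integrand (fun x => c' * (x 0) ^ (-(3:ℝ)/4) * (1 - x 0) ^ (-(3:ℝ)/4))
      r₂.domain)
    (h₁ : KZ.Equivalent r r₁) (h₂ : KZ.Equivalent r r₂) : c = c' := by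
  have hv₁ : r.value = r₁.value := KZ.Equivalent.value_eq_holds h₁
  have hv₂ : r.value = r₂.value := KZ.Equivalent.value_eq_holds h₂
  rw [value_eq_const_mul r₁ c hd₁ hi₁] at hv₁
  rw [value_eq_const_mul r₂ c' hd₂ hi₂] at hv₂
  have hpos := value_pos_of_pinned r hd hi
  have hI : (∫ x in unitIoo, (x 0) ^ (-(3:ℝ)/4) * (1 - x 0) ^ (-(3:ℝ)/4)) ≠ 0 := fun h0 => by
    rw [h0, mul_zero] at hv₁
    exact hpos.ne' hv₁
  exact mul_right_cancel₀ hI (hv₁.symm.trans hv₂)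

/-- Corollary: under the crux, `c₀` is the ONLY constant for which the scaled pair is
equivalent. -/
theorem constant_forced (h : Theses.TerasomaMultiplication.DasGapTwelve) {c : ℝ}
    (r₁ : KZ.IntegralRep 1) (hd₁ : r₁.domain = {x | x 0 ∈ Set.Ioo (0:ℝ) 1})
    (hi₁ : Set.EqOn r₁.integrand (fun x => c * (x 0) ^ (-(3:ℝ)/4) * (1 - x 0) ^ (-(3:ℝ)/4))
      r₁.domain)
    (h₁ : KZ.Equivalent repB_1_12_1_4 r₁) : c = c₀ :=
  constant_unique repB_1_12_1_4 r₁ repC₀B rfl repB_1_12_1_4_eqOn hd₁ hi₁ rfl (fun _ _ => rfl) h₁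
    (dasGapTwelve_iff_instance.mp h)

end Tightness

/-! ## Load-bearing analysis, family version: the constant as a parameter -/
section Scaled

/-- FAMILY (constant): the crux with `c₀` replaced by a real parameter `c`
(`c = 1` is the constant-dropped variant up to `one_mul`). -/
def DasGapTwelveScaled (c : ℝ) : Prop :=
  ∀ (r r' : KZ.IntegralRep 1), r.domain = {x | x 0 ∈ Set.Ioo (0:ℝ) 1} →
    Set.EqOn r.integrand (fun x => (x 0) ^ (-(11:ℝ)/12) * (1 - x 0) ^ (-(3:ℝ)/4)) r.domain →
    r'.domain = {x | x 0 ∈ Set.Ioo (0:ℝ) 1} →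
    Set.EqOn r'.integrand (fun x => c * (x 0) ^ (-(3:ℝ)/4) * (1 - x 0) ^ (-(3:ℝ)/4)) r'.domain →
    KZ.Equivalent r r'

/-- ANCHOR: the crux is the member `c = c₀` of the family (definitionally). -/
theorem dasGapTwelve_iff_scaled : Theses.TerasomaMultiplication.DasGapTwelve ↔ DasGapTwelveScaled c₀ :=
  Iff.rfl

/-- Pointwise strict comparison of the two Beta kernels on `(0,1)`. -/
theorem kernel_lt {t : ℝ} (ht : t ∈ Set.Ioo (0:ℝ) 1) :
    t ^ (-(3:ℝ)/4) * (1 - t) ^ (-(3:ℝ)/4) < t ^ (-(11:ℝ)/12) * (1 - t) ^ (-(3:ℝ)/4) := by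
  have h1 : 0 < (1 - t) ^ (-(3:ℝ)/4) := Real.rpow_pos_of_pos (by linarith [ht.2]) _
  have h2 : t ^ (-(3:ℝ)/4) < t ^ (-(11:ℝ)/12) :=
    Real.rpow_lt_rpow_of_exponent_gt ht.1 ht.2 (by norm_num)
  exact mul_lt_mul_of_pos_right h2 h1

/-- `B(1/4,1/4) < B(1/12,1/4)` in the form needed: the bare kernel integral is below the value of
ANY pinned `B(1/12,1/4)` representation (integrability of the kernel from the witness construction,
of `r` from `r` itself). -/
theorem kernelIntegral_lt_value (r : KZ.IntegralRep 1) (hd : r.domain = {x | x 0 ∈ Set.Ioo (0:ℝ) 1})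
    (hi : Set.EqOn r.integrand (fun x => (x 0) ^ (-(11:ℝ)/12) * (1 - x 0) ^ (-(3:ℝ)/4)) r.domain) :
    (∫ x in unitIoo, (x 0) ^ (-(3:ℝ)/4) * (1 - x 0) ^ (-(3:ℝ)/4)) < r.value := by
  have hr : IntegrableOn r.integrand unitIoo := by
    have h := r.integrableOn; rw [hd] at h; exact h
  have hg : IntegrableOn (fun x : Fin 1 → ℝ => (x 0) ^ (-(3:ℝ)/4) * (1 - x 0) ^ (-(3:ℝ)/4)) unitIoo :=
    integrableOn_rpow_mul_rpow (by norm_num) (by norm_num)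
  rw [← sub_pos]
  unfold KZ.IntegralRep.value
  rw [hd, ← integral_sub hr hg]
  refine (setIntegral_pos_iff_support_of_nonneg_ae ?_ (hr.sub hg)).mpr ?_
  · refine ae_restrict_of_forall_mem measurableSet_unitIoo fun x hx => ?_
    have hx1 : x ∈ r.domain := by rw [hd]; exact hx
    simp only [Pi.zero_apply, Pi.sub_apply]
    rw [hi hx1]
    exact (sub_pos.mpr (kernel_lt hx)).le
  · have hsupp : Function.support (r.integrand - fun x : Fin 1 → ℝ =>
        (x 0) ^ (-(3:ℝ)/4) * (1 - x 0) ^ (-(3:ℝ)/4)) ∩ unitIoo = unitIoo := by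
      refine Set.inter_eq_right.mpr fun x hx => ?_
      rw [Function.mem_support, Pi.sub_apply]
      have hx1 : x ∈ r.domain := by rw [hd]; exact hx
      rw [hi hx1]
      exact (sub_pos.mpr (kernel_lt hx)).ne'
    rw [hsupp]
    exact volume_unitIoo_pos

/-- The bare kernel integral is nonnegative. -/
theorem kernelIntegral_nonneg :
    0 ≤ ∫ x in unitIoo, (x 0) ^ (-(3:ℝ)/4) * (1 - x 0) ^ (-(3:ℝ)/4) :=
  setIntegral_nonneg measurableSet_unitIoo fun _ hx =>
    (mul_pos (Real.rpow_pos_of_pos hx.1 _) (Real.rpow_pos_of_pos (sub_pos.2 hx.2) _)).le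

/-- **Load-bearing (constant), universal form.** For every real `c ≤ 1` NO pinned pair of the
family is equivalent: `value r' = c·∫kernel ≤ ∫kernel < value r`. In particular dropping `c₀`
(`c = 1`), zeroing it or flipping its sign kills the statement; the chain must create `c₀ > 1`. -/
theorem not_equivalent_of_le_one {c : ℝ} (hc : c ≤ 1) (r r' : KZ.IntegralRep 1)
    (hd : r.domain = {x | x 0 ∈ Set.Ioo (0:ℝ) 1})
    (hi : Set.EqOn r.integrand (fun x => (x 0) ^ (-(11:ℝ)/12) * (1 - x 0) ^ (-(3:ℝ)/4)) r.domain)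
    (hd' : r'.domain = {x | x 0 ∈ Set.Ioo (0:ℝ) 1})
    (hi' : Set.EqOn r'.integrand (fun x => c * (x 0) ^ (-(3:ℝ)/4) * (1 - x 0) ^ (-(3:ℝ)/4))
      r'.domain) :
    ¬ KZ.Equivalent r r' := fun h => by
  have hv : r.value = r'.value := KZ.Equivalent.value_eq_holds h
  rw [value_eq_const_mul r' c hd' hi'] at hv
  have h1 := kernelIntegral_lt_value r hd hi
  have h2 := mul_le_of_le_one_left kernelIntegral_nonneg hc
  linarith

/-- **Instance `c = 1`**: the constant-dropped variant of the crux is FALSE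
(witnesses `repB_1_12_1_4`, `repB_1_4_1_4`). -/
theorem not_dasGapTwelveScaled_one : ¬ DasGapTwelveScaled 1 := fun h =>
  not_equivalent_of_le_one le_rfl repB_1_12_1_4 repB_1_4_1_4 rfl repB_1_12_1_4_eqOn rfl
    (fun x hx => (repB_1_4_1_4_eqOn hx).trans (by simp only [one_mul]))
    (h _ _ rfl repB_1_12_1_4_eqOn rfl fun x hx => (repB_1_4_1_4_eqOn hx).trans (by simp only [one_mul]))

end Scaled

/-! ## Anchor in the route: the crux is the `N = N' = 1, k = 0` instance of `GammaHodgeSector` -/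
section Sector

/-- `c₀` is algebraic over `ℚ`: a root of `(T^8 - 189)^2 - 34992`. -/
theorem isAlgebraic_c₀ : IsAlgebraic ℚ c₀ := by
  refine ⟨(Polynomial.X ^ 8 - Polynomial.C 189) ^ 2 - Polynomial.C 34992, ?_, ?_⟩
  · intro h
    have h0 := congrArg (Polynomial.eval 0) h
    simp only [Polynomial.eval_sub, Polynomial.eval_pow, Polynomial.eval_X, Polynomial.eval_C,
      Polynomial.eval_zero] at h0
    norm_num at h0
  · simp only [map_sub, map_pow, Polynomial.aeval_X, Polynomial.aeval_C, eq_ratCast]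
    rw [show ((189:ℚ):ℝ) = 189 by norm_num, show ((34992:ℚ):ℝ) = 34992 by norm_num,
      c₀_pow_eight_sub_sq, sub_self]

/-- The Deligne–Koblitz–Ogus Hodge-type condition of the pair `(1/12,1/4 ; 1/4,1/4)`, weight `0`,
for every `u` coprime to `12` (reduction to `u mod 12 ∈ {1,5,7,11}`). -/
theorem hodge_condition (u : ℕ) (hu : Nat.Coprime u 12) :
    Int.fract ((u:ℚ) * (1/12)) + Int.fract ((u:ℚ) * (1/4)) - Int.fract ((u:ℚ) * (1/12 + 1/4))
      - (Int.fract ((u:ℚ) * (1/4)) + Int.fract ((u:ℚ) * (1/4)) - Int.fract ((u:ℚ) * (1/4 + 1/4)))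
      = 0 := by
  have h2 : ¬ 2 ∣ u := by
    have h := Nat.Coprime.coprime_dvd_right (show 2 ∣ 12 by norm_num) hu
    rwa [Nat.coprime_comm, Nat.prime_two.coprime_iff_not_dvd] at h
  have h3 : ¬ 3 ∣ u := by
    have h := Nat.Coprime.coprime_dvd_right (show 3 ∣ 12 by norm_num) hu
    rwa [Nat.coprime_comm, Nat.prime_three.coprime_iff_not_dvd] at h
  rw [show (u:ℚ) * (1/12) = (u:ℚ) / ((12:ℕ):ℚ) by push_cast; ring,
    show (u:ℚ) * (1/4) = (u:ℚ) / ((4:ℕ):ℚ) by push_cast; ring,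
    show (u:ℚ) * (1/12 + 1/4) = (u:ℚ) / ((3:ℕ):ℚ) by push_cast; ring,
    show (u:ℚ) * (1/4 + 1/4) = (u:ℚ) / ((2:ℕ):ℚ) by push_cast; ring]
  simp only [Int.fract_div_natCast_eq_div_natCast_mod]
  have h12 : u % 12 = 1 ∨ u % 12 = 5 ∨ u % 12 = 7 ∨ u % 12 = 11 := by omega
  rcases h12 with h | h | h | h
  · rw [h, show u % 4 = 1 by omega, show u % 3 = 1 by omega, show u % 2 = 1 by omega]
    push_cast; norm_num
  · rw [h, show u % 4 = 1 by omega, show u % 3 = 2 by omega, show u % 2 = 1 by omega]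
    push_cast; norm_num
  · rw [h, show u % 4 = 3 by omega, show u % 3 = 1 by omega, show u % 2 = 1 by omega]
    push_cast; norm_num
  · rw [h, show u % 4 = 3 by omega, show u % 3 = 2 by omega, show u % 2 = 1 by omega]
    push_cast; norm_num

/-- **The crux is an instance of the route's crux 5 (`GammaHodgeSector`), modulo the value
identity.**  Given `GammaHodgeSector` and the (classical, not formalised) equality of the two
values `B(1/12,1/4) = c₀ B(1/4,1/4)`, `DasGapTwelve` follows: data `N = N' = 1`, `k = 0`,
`x = 1/12, y = 1/4, x' = y' = 1/4`, `c = c₀` (algebraic: `isAlgebraic_c₀`; Hodge condition: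
`hodge_condition`).  So the crux isolates no mechanism of its own beyond the sector crux; its point
is the lattice position of the pair (`Lattice12`). -/
theorem dasGapTwelve_of_gammaHodgeSector
    (hG : Theses.TerasomaMultiplication.GammaHodgeSector)
    (hval : repB_1_12_1_4.value = repC₀B.value) :
    Theses.TerasomaMultiplication.DasGapTwelve := by
  rw [dasGapTwelve_iff_instance]
  have e : ∀ l : Fin 1, Fin.natAdd 0 l = l := fun l => Fin.ext (by simp)
  refine hG 1 1 0 (fun _ => 1/12) (fun _ => 1/4) (fun _ => 1/4) (fun _ => 1/4) c₀ ?_ ?_ ?_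
    isAlgebraic_c₀ repB_1_12_1_4 repC₀B ?_ ?_ ?_ ?_ hval
  · intro j; norm_num
  · intro l; norm_num
  · intro u _ hcop _
    have h12 : Nat.Coprime u 12 := by
      have h := (hcop 0).1
      rwa [show ((fun _ : Fin 1 => (1/12 : ℚ)) 0).den = 12 by
        show (1/12 : ℚ).den = 12
        rw [one_div, Rat.inv_ofNat_den]] at h
    simp only [Fin.sum_univ_one, Nat.cast_zero]
    exact hodge_condition u h12
  · ext t
    simp only [Set.mem_setOf_eq, Fin.forall_fin_one]
    rfl
  · intro t ht
    simp only [Fin.prod_univ_one]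
    rw [repB_1_12_1_4_eqOn ht]
    norm_num
  · show unitIoo = {z : Fin 1 → ℝ | (∑ i : Fin 0, z (Fin.castAdd 1 i) ^ 2) < 1 ∧
      ∀ l : Fin 1, z (Fin.natAdd 0 l) ∈ Set.Ioo 0 1}
    ext z
    simp only [Finset.univ_eq_empty, Finset.sum_empty, zero_lt_one, true_and, Set.mem_setOf_eq,
      Fin.forall_fin_one, e]
  · intro z hz
    show repC₀B.integrand z = c₀ * ((Nat.factorial 0 : ℕ) : ℝ) *
      ∏ l : Fin 1, (z (Fin.natAdd 0 l) ^ ((((fun _ : Fin 1 => (1/4:ℚ)) l : ℚ) : ℝ) - 1) *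
        (1 - z (Fin.natAdd 0 l)) ^ ((((fun _ : Fin 1 => (1/4:ℚ)) l : ℚ) : ℝ) - 1))
    simp only [Fin.prod_univ_one, e, Nat.factorial_zero, Nat.cast_one, mul_one]
    show c₀ * z 0 ^ (-(3:ℝ)/4) * (1 - z 0) ^ (-(3:ℝ)/4) =
      c₀ * (z 0 ^ (((1/4:ℚ):ℝ) - 1) * (1 - z 0) ^ (((1/4:ℚ):ℝ) - 1))
    rw [show ((1/4:ℚ):ℝ) - 1 = -(3:ℝ)/4 by norm_num, mul_assoc]

end Sector

/-! ## `c₀` is irrational: no rational rescaling can work -/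
section Irrational

/-- `c₀ ∉ ℚ` (else `√3 = (c₀^8 - 189)/108` would be rational). -/
theorem irrational_c₀ : Irrational c₀ := by
  intro ⟨q, hq⟩
  have h3 : Irrational (Real.sqrt 3) := by
    simpa using Nat.Prime.irrational_sqrt (p := 3) Nat.prime_three
  apply h3
  refine ⟨(q ^ 8 - 189) / 108, ?_⟩
  have h := c₀_pow_eight
  rw [← hq] at h
  push_cast
  linarith

/-- Under the crux, NO rational constant makes the scaled pair equivalent (`constant_forced` +
`irrational_c₀`): every chain must perform an irrational algebraic rescaling. -/
theorem no_rational_constant (h : Theses.TerasomaMultiplication.DasGapTwelve) (q : ℚ)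
    (r₁ : KZ.IntegralRep 1) (hd₁ : r₁.domain = {x | x 0 ∈ Set.Ioo (0:ℝ) 1})
    (hi₁ : Set.EqOn r₁.integrand (fun x => (q:ℝ) * (x 0) ^ (-(3:ℝ)/4) * (1 - x 0) ^ (-(3:ℝ)/4))
      r₁.domain) :
    ¬ KZ.Equivalent repB_1_12_1_4 r₁ := fun h₁ =>
  irrational_c₀ ⟨q, (constant_forced h r₁ hd₁ hi₁ h₁)⟩

end Irrational

/-! ## The level-12 lattice certificate (standard relations do not reach the gap class) -/
namespace Lattice12

/-- Basis vector `[i/12]` of the level-12 Gamma-monomial lattice `ℤ^{(1/12)ℤ/ℤ}`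
(coordinate `0`, the integer point, is never used by the generators below). -/
def e (i : Fin 12) : Fin 12 → ℤ := fun j => if j = i then 1 else 0

/-- Euler reflection vector `[x] + [-x]` (`Γ(x)Γ(1-x) = π / sin πx`). -/
def refl (j : Fin 12) : Fin 12 → ℤ := e j + e (-j)

/-- Gauss multiplication vector `Σ_{k<m} [x + k/m] - [m x]` for `m ∣ 12`
(`Π_k Γ(x+k/m) = (2π)^{(m-1)/2} m^{1/2-mx} Γ(mx)`). -/
def mult (m : ℕ) (j : Fin 12) : Fin 12 → ℤ :=
  ((List.range m).map fun k => e (j + Fin.ofNat 12 (k * (12 / m)))).sum - e (Fin.ofNat 12 m * j)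

/-- Generators of the standard relations at level 12: all reflections at `x ≠ 0` and all
multiplications `m ∈ {2,3,4,6,12}` at `x` with `m x ∉ ℤ`. -/
def gens : Set (Fin 12 → ℤ) :=
  {v | ∃ j : Fin 12, j ≠ 0 ∧ v = refl j} ∪
  {v | ∃ m : ℕ, m ∈ [2, 3, 4, 6, 12] ∧ ∃ j : Fin 12, Fin.ofNat 12 m * j ≠ 0 ∧ v = mult m j}

/-- The `ℤ`-span `S₁₂` of the standard (reflection + multiplication) relations at level 12. -/
def standardSpan : AddSubgroup (Fin 12 → ℤ) := AddSubgroup.closure gens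

/-- The Yamamoto–Das gap class `a = [1/12] - [1/4] - [1/3]` (Hodge type, weight `-1/2`). -/
def gapClass : Fin 12 → ℤ := e 1 - e 3 - e 4

/-- The class of the crux's Beta pair `B(1/12,1/4) - B(1/4,1/4)`:
`([1]+[3]-[4]) - (2[3]-[6])`. -/
def betaPairClass : Fin 12 → ℤ := (e 1 + e 3 - e 4) - (2 • e 3 - e 6)

/-- The parity functional `χ(v) = v₁ + v₅ + v₇ + v₁₁ mod 2`, as the subgroup `{χ = 0}`. -/
def parity : AddSubgroup (Fin 12 → ℤ) where
  carrier := {v | 2 ∣ v 1 + v 5 + v 7 + v 11}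
  add_mem' := by
    intro a b ha hb
    simp only [Set.mem_setOf_eq, Pi.add_apply] at *
    obtain ⟨k, hk⟩ := ha
    obtain ⟨l, hl⟩ := hb
    exact ⟨k + l, by linarith⟩
  zero_mem' := by simp
  neg_mem' := by
    intro a ha
    simp only [Set.mem_setOf_eq, Pi.neg_apply] at *
    obtain ⟨k, hk⟩ := ha
    exact ⟨-k, by linarith⟩

theorem refl_even : ∀ j : Fin 12, 2 ∣ refl j 1 + refl j 5 + refl j 7 + refl j 11 := by decide

theorem mult_even : ∀ m ∈ [2, 3, 4, 6, 12], ∀ j : Fin 12, Fin.ofNat 12 m * j ≠ 0 →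
    2 ∣ mult m j 1 + mult m j 5 + mult m j 7 + mult m j 11 := by decide

theorem gens_subset_parity : gens ⊆ parity := by
  rintro v (⟨j, -, rfl⟩ | ⟨m, hm, j, hj, rfl⟩)
  · exact refl_even j
  · exact mult_even m hm j hj

theorem standardSpan_le_parity : standardSpan ≤ parity :=
  (AddSubgroup.closure_le parity).mpr gens_subset_parity

/-- **The gap class is not a standard relation at level 12** (parity certificate). -/
theorem gapClass_not_mem_standardSpan : gapClass ∉ standardSpan := fun h => by
  have h2 : (2:ℤ) ∣ gapClass 1 + gapClass 5 + gapClass 7 + gapClass 11 := standardSpan_le_parity h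
  revert h2
  decide

/-- **Nor is the Beta-pair class of the crux** (it differs from `gapClass` by `[1/2] ∈ S₁₂`). -/
theorem betaPairClass_not_mem_standardSpan : betaPairClass ∉ standardSpan := fun h => by
  have h2 : (2:ℤ) ∣ betaPairClass 1 + betaPairClass 5 + betaPairClass 7 + betaPairClass 11 :=
    standardSpan_le_parity h
  revert h2
  decide

theorem refl_mem (j : Fin 12) (hj : j ≠ 0) : refl j ∈ standardSpan :=
  AddSubgroup.subset_closure (Or.inl ⟨j, hj, rfl⟩)

theorem mult_mem (m : ℕ) (hm : m ∈ [2, 3, 4, 6, 12]) (j : Fin 12) (hj : Fin.ofNat 12 m * j ≠ 0) :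
    mult m j ∈ standardSpan :=
  AddSubgroup.subset_closure (Or.inr ⟨m, hm, j, hj, rfl⟩)

/-- **Only the square is standard**: `2a ∈ S₁₂`, by the classical derivation of `Γ(1/12)²`
(Gauss-3 at 1/12, Legendre at 1/12 and 1/6, reflections at 5/12, 1/4, 1/3). -/
theorem two_smul_gapClass_mem_standardSpan : (2 : ℕ) • gapClass ∈ standardSpan := by
  have key : (2 : ℕ) • gapClass = mult 3 1 + mult 2 1 - refl 5 + mult 2 2 - refl 3 - refl 4 := by
    decide
  rw [key]
  refine sub_mem (sub_mem (add_mem (sub_mem (add_mem ?_ ?_) ?_) ?_) ?_) ?_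
  · exact mult_mem 3 (by decide) 1 (by decide)
  · exact mult_mem 2 (by decide) 1 (by decide)
  · exact refl_mem 5 (by decide)
  · exact mult_mem 2 (by decide) 2 (by decide)
  · exact refl_mem 3 (by decide)
  · exact refl_mem 4 (by decide)

/-- `[1/2] ∈ S₁₂` (`refl 3 - mult 2 3`), so `betaPairClass ≡ gapClass (mod S₁₂)`. -/
theorem betaPairClass_sub_gapClass_mem : betaPairClass - gapClass ∈ standardSpan := by
  have key : betaPairClass - gapClass = refl 3 - mult 2 3 := by decide
  rw [key]
  exact sub_mem (refl_mem 3 (by decide)) (mult_mem 2 (by decide) 3 (by decide))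

/-- Anderson's canonical basis element `a_{2·3} = [1/4] - [5/12] - [1/3]` of the 2-torsion of
the universal odd distribution `U⁻` (Kubert: the torsion of `U⁻` is killed by 2; Das 2000 /
Anderson 2002: the classes `a_{pq}`, `p < q` prime, form its canonical `ℤ/2`-basis; `{p,q} =
{2,3}` is level 12), read in this lattice.  In Anderson's normalisation `Γ[a] = √(2π)/Γ(a)` one has
`Γ(a_{2·3}) = Γ(5/12)Γ(1/3)/(√(2π)Γ(1/4)) = 2^(-1/4)3^(1/8)√(sin(π/4)/(2 sin(5π/12) sin(π/3)))`
(Anderson 2002, Introduction), which equals `3^(1/4)/c₀` for the crux's constant `c₀`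
(`Γ(1/12)Γ(5/12) = √2·3^(1/4)Γ(1/4)²`; checked to 1e-16).
[cite: Anderson2002KroneckerWeberEpsilon, Introduction] -/
def andersonClass : Fin 12 → ℤ := e 3 - e 5 - e 4

/-- The crux's gap class IS Anderson's `a_{2·3}` modulo the standard relations of this lattice:
`gapClass - andersonClass = mult 3 1 - refl 3` (Gauss-3 at 1/12 minus the reflection at 1/4).
[cite: Anderson2002KroneckerWeberEpsilon, Introduction] -/
theorem gapClass_sub_andersonClass_mem : gapClass - andersonClass ∈ standardSpan := by
  have key : gapClass - andersonClass = mult 3 1 - refl 3 := by decide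
  rw [key]
  exact sub_mem (mult_mem 3 (by decide) 1 (by decide)) (refl_mem 3 (by decide))

/-- Anderson's class is not a standard relation at level 12 either (parity certificate).
[cite: Anderson2002KroneckerWeberEpsilon, Introduction] -/
theorem andersonClass_not_mem_standardSpan : andersonClass ∉ standardSpan := fun h => by
  have h2 : (2:ℤ) ∣ andersonClass 1 + andersonClass 5 + andersonClass 7 + andersonClass 11 :=
    standardSpan_le_parity h
  revert h2
  decide

end Lattice12

end Summit.KontsevichZagierPeriods.KontsevichZagierPeriods.Cruxes.DasGapTwelve.Disproof
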